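import Summits.NavierStokesRegularity.FunctionalMining.BiaxialXRayTorus
import HarnessLib

/-!
# FunctionalMining — X-ray constraints for a biaxial strain of VARIABLE modulus
# `S(v)(y) = m(y)(1 − 3 n(y)⊗n(y))` (the "biaxial at every point" class of `SIEVELD.md` §3.4b (4h))

Search for candidate a priori estimates; no regularity claim. Cell `pub-nsfunc`, prove seat (gen 20).
Static calculus of smooth fields on the flat torus; nothing about Navier–Stokes dynamics.
`BiaxialXRay` / `BiaxialXRayTorus` treat a CONSTANT modulus `m ≠ 0`; `SIEVELD.md` §3.4b (4h) remarks that
for a variable modulus `m(x)` no periodic divergence-free example is known either. The X-ray identities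
themselves are statements about `S(v)` alone, so they transfer verbatim: the `m`-weighted averages of
`|k|² − 3(k·n)²` over closed lattice lines and of `a·b − 3(a·n)(b·n)` over rational 2-tori vanish. No
regularity or even measurability of `m` and `n` separately is needed — only the pointwise identity
`S(v)(y) = m(y)(1 − 3n(y)⊗n(y))` (the integrands are rewritten as `kᵀS(v)k`, resp. `aᵀS(v)b`).

* `intervalIntegral_axis_longitudinal_var`: `∫₀¹ m(x+tk)·(|k|² − 3(k·n(x+tk))²) dt = 0` (lattice `k`).
* `intervalIntegral₂_axis_mixed_var`: `∫₀¹∫₀¹ m·(a·b − 3(a·n)(b·n))(x+sa+tb) dt ds = 0` (lattice `a, b`).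
(The magic-angle points for variable modulus are `exists_axis_magic_angle_var` /
`exists_axis_magic_angle_line_var` in `BiaxialMagicAngle`.) [ours]
-/

noncomputable section

open MeasureTheory Set Filter Topology intervalIntegral

namespace Summit.NavierStokesRegularity.FunctionalMining
open Literature.Analysis Literature.Analysis.FunctionSpaces Literature.Analysis.FunctionSpaces.Torus
  Literature.Analysis.FluidPDE

namespace BiaxialEikonal

variable {d : Type*} [Fintype d] [DecidableEq d]

/-- **Weighted X-ray constraint on closed lattice lines, variable modulus**: if
`S(v)(y) = m(y)(1 − 3n(y)⊗n(y))` pointwise then `∫₀¹ m(x + tk)(|k|² − 3(k·n(x + tk))²) dt = 0` for every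
lattice `k` and every `x`. [ours] -/
theorem intervalIntegral_axis_longitudinal_var {v : UnitAddTorus d → EuclideanSpace ℝ d}
    (hv : Torus.IsSmooth v) {m : UnitAddTorus d → ℝ} {n : UnitAddTorus d → d → ℝ}
    (hS : ∀ y, torusStrainMatrix v y = m y • (1 - (3 : ℝ) • Matrix.vecMulVec (n y) (n y)))
    (k : d → ℤ) (x : UnitAddTorus d) :
    ∫ t in (0 : ℝ)..1, m (x + proj (t • latticeVec k)) *
      (∑ i, (latticeVec k) i ^ 2 - 3 * (∑ i, (latticeVec k) i * n (x + proj (t • latticeVec k)) i) ^ 2) = 0 := by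
  have h := intervalIntegral_longitudinalStrain_eq_zero hv k x
  have e : ∀ t : ℝ, ∑ i, ∑ j, (latticeVec k) i * (latticeVec k) j *
      torusStrainMatrix v (x + proj (t • latticeVec k)) i j =
      m (x + proj (t • latticeVec k)) * (∑ i, (latticeVec k) i ^ 2
        - 3 * (∑ i, (latticeVec k) i * n (x + proj (t • latticeVec k)) i) ^ 2) := fun t => by
    rw [hS, longitudinal_biaxial]
  simp_rw [e] at h
  exact h

/-- **Weighted X-ray constraint on rational 2-tori, variable modulus**: if
`S(v)(y) = m(y)(1 − 3n(y)⊗n(y))` pointwise then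
`∫₀¹∫₀¹ m·(a·b − 3(a·n)(b·n))(x + sa + tb) dt ds = 0` for lattice `a, b` and every `x`. [ours] -/
theorem intervalIntegral₂_axis_mixed_var {v : UnitAddTorus d → EuclideanSpace ℝ d}
    (hv : Torus.IsSmooth v) {m : UnitAddTorus d → ℝ} {n : UnitAddTorus d → d → ℝ}
    (hS : ∀ y, torusStrainMatrix v y = m y • (1 - (3 : ℝ) • Matrix.vecMulVec (n y) (n y)))
    (a b : d → ℤ) (x : UnitAddTorus d) :
    ∫ s in (0 : ℝ)..1, ∫ t in (0 : ℝ)..1, m (x + proj (s • latticeVec a + t • latticeVec b)) *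
      (∑ i, (latticeVec a) i * (latticeVec b) i -
        3 * ((∑ i, (latticeVec a) i * n (x + proj (s • latticeVec a + t • latticeVec b)) i) *
          ∑ i, (latticeVec b) i * n (x + proj (s • latticeVec a + t • latticeVec b)) i)) = 0 := by
  have h := intervalIntegral₂_mixedStrain_eq_zero hv a b x
  have e : ∀ s t : ℝ, ∑ i, ∑ j, (latticeVec a) i * (latticeVec b) j *
      torusStrainMatrix v (x + proj (s • latticeVec a + t • latticeVec b)) i j =
      m (x + proj (s • latticeVec a + t • latticeVec b)) * (∑ i, (latticeVec a) i * (latticeVec b) i -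
        3 * ((∑ i, (latticeVec a) i * n (x + proj (s • latticeVec a + t • latticeVec b)) i) *
          ∑ i, (latticeVec b) i * n (x + proj (s • latticeVec a + t • latticeVec b)) i)) := fun s t => by
    rw [hS, mixed_biaxial]
  simp_rw [e] at h
  exact h

/-- Coordinate circles, variable modulus: `∫₀¹ m(x + t eⱼ)(1 − 3 nⱼ(x + t eⱼ)²) dt = 0`. [ours] -/
theorem intervalIntegral_axis_coord_var {v : UnitAddTorus d → EuclideanSpace ℝ d}
    (hv : Torus.IsSmooth v) {m : UnitAddTorus d → ℝ} {n : UnitAddTorus d → d → ℝ}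
    (hS : ∀ y, torusStrainMatrix v y = m y • (1 - (3 : ℝ) • Matrix.vecMulVec (n y) (n y)))
    (j : d) (x : UnitAddTorus d) :
    ∫ t in (0 : ℝ)..1, m (x + proj (t • EuclideanSpace.single j (1 : ℝ))) *
      (1 - 3 * n (x + proj (t • EuclideanSpace.single j (1 : ℝ))) j ^ 2) = 0 := by
  have h := intervalIntegral_axis_longitudinal_var hv hS (Pi.single j 1) x
  rw [latticeVec_single] at h
  simpa [PiLp.single_apply, Pi.single_apply, Finset.sum_ite_eq', Finset.mem_univ] using h

end BiaxialEikonal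

end Summit.NavierStokesRegularity.FunctionalMining

end
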